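import Summits.QuantumFields.BalabanUV.Beta.GAN24.ExchangeWordCellPairing

/-!
# `BalabanUV.Beta.GAN24.ExchangeE2E2Channel` — binder row G-an2-4 ∕ (CONV-C), W-slot (α-0), ROW (C) AT LEVELS `j ≥ 1`, (W6) of the (γ) hand's memo
# `HOME/b2b-balaban-gan24-formalise-leaf-06/g52/C-LEVELS-GE1.md` §19–§20: **THE E-SECTOR EE WORD OF ROW (C) AT LEVEL `j+1` IN TWO-FACE CURRENCY — both half-vertices
# split into «`Lc⁻¹·τ ± (2Lc)⁻¹·e`» (tower slot ∕ value-Hessian image of the sawtooth exit-face profile), and THE `e–e` CHANNEL EVALUATED: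
# `Σ_{x∈cell} Σ_a e_L(a,x)·(X̃♮ e_R)(a,x) = sf²·wVH⁻¹·Σ_{x∈cell} (λ_μχ_α)(x)·(E2_{j+1}(λ̂_νχ_β))_{αβ}(x)`** — every `j`, in-block root, every `d`, `Lc ≥ 1`, `ν ≠ β`
# (G-an2-4 CRUX TEAM (2), seat `b2b-balaban-gan24-formalise-leaf-06` = the (γ) hand, gen 52; journal INTENT I-leaf06-g52-12)

NOT IN PRINT; OUR BOOKKEEPING ([folklore] BY NAME: `ExchangeWordCellPairing.exchangeWord_eq_cellPairing` (regrouping + resummation, generic `S`), `ExchangeE2E2ChannelTools`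
(`faceface_unitS_smul`), `ExitFaceHalfVertexSplit` (`faceface_e3OfK_split_sawtooth`, `faceface_e3OfK_split_fst_sawtooth`), `ExchangeE2E2ChannelValue` (`sum_box_channel_sawFace`,
§1 bounds), `ValueHessianLinearGauge.tsum_E2_mul_exitFace_eq_zero'`, `StepCovarianceSandwichApply.summable_apply_bdd`, an2's `locStencil_e3OfK` ∕ `e3OfK_translate`, leaf-10's
`locStencil_SrecAt` ∕ `SrecAt_translate`; 0 `def`, 0 cited fact, 0 `def … : Prop`, 0 sorry).
HONEST FRAMING (cell contract, verbatim): «discharging `BetaPertH` makes Bałaban's UV stability UNCONDITIONAL — a real constructive-QFT result; it is NOT the continuum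
limit and NOT the Clay problem.»  HONEST DEPENDENCY (verbatim): «continuum YM on T⁴ ⇐ BetaPertH ∧ nine spine estimates (0/9 proved); BetaPertH ⇐ (D1) ∧ (D4) ∧ CAP+tail;
G-an2-4 gates asym, D1 and NE2/3/4.»
NOTATION (level `j`, in-block root `ρ = toSite r`, pins `(cE′, cVH) = (Lc^{d+1}, −Lc^{d+1}·½·Lc^{d+1})`, any `cΛ`, sector amplitude `cE`): `V_j := e3OfK Lc G_j (SrecAt … j)`,
`S_E := cE • V_j`, `X̃♮ := unitK sf sm G_{j+1}` (`G_j = coDressKBmAt ρ Lc (KInvStep Lc j)`; the word of row (C) at level `j+1` has its vertices and its middle kernel at level `j+1` and its source table built from level `j`), `χ_α(y) = [y_α % Lc = Lc−1]`, `λ_μ(y) = y_μ % Lc`, `λ̂_ν = λ_ν − (Lc−1)∕2`,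
`K_E = (sf sm)⁻¹·sf⁻²·cE`, `c₀σ_{j+1} = (Lc·(sm sf))·((Lc^{j+2})^{d+2})⁻¹`; `τ_L(a,x) = Σ'_y χ_α(y)·Σ'_t V μ t y x (inl α)(inl a)`, `e_L(a,x) = Σ'_y (λ_μχ_α)(y)·E2_{j+1}(y,x)_{αa}`,
`τ_R(b,z) = Σ'_{s′} χ_β(s′)·Σ'_t V ν t z s′ (inl b)(inl β)`, `e_R(b,z) = Σ'_{s′} E2_{j+1}(z,s′)_{bβ}·(λ_νχ_β)(s′)`.
* §1 `locStencil_sectorTable`, `sectorTable_translate`, `faceface_unitS_smul_fst` — the E-sector table is admissible for `ExchangeWordCellPairing`; units through the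
  first-slot two-face sum (twin of Tools §1).
* §2 `abs_towerSlotR_le`, `towerSlotR_summable`, `eR_summable`, **`dressedStep_apply_faceface_split`** — `(X̃♮ FF_R)(a,x) = K_E·(Lc⁻¹·(X̃♮ τ_R)(a,x) − (2Lc)⁻¹·(X̃♮ e_R)(a,x))`.
* §3 **`exchangeWord_sector_eq`** — THE E-SECTOR EE WORD (level `j+1`) `= |box|·c₀σ_{j+1}²·K_E²·Σ_{x∈box} Σ_a (Lc⁻¹τ_L + (2Lc)⁻¹e_L)(a,x)·(Lc⁻¹·X̃♮τ_R − (2Lc)⁻¹·X̃♮e_R)(a,x)`.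
* §4 `eR_eq_centred`, **`channel_ee_value`** (`ν ≠ β`) — `Σ_{x∈box} Σ_a e_L(a,x)·(X̃♮ e_R)(a,x) = sf²·(wVH_{j+1}⁻¹·Σ_{x∈box} (λ_μχ_α)(x)·Σ'_s E2_{j+1}(x,s)_{αβ}·(λ̂_νχ_β)(s))`
  (`e_R` is unchanged by centring the sawtooth — `E2` kills the exit-face profile — and then `ExchangeE2E2ChannelValue.sum_box_channel_sawFace`).
The three `τ` pairings of §3 are (W4)∕(W7) (tower ∕ kernel-leg letters; an2's `KernelLegPullback`). Asserts NO value of Bałaban's tables; discharges NOTHING of (C) ∕ (C)sym ∕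
(Q-L) ∕ «T2Shape» ∕ «T2Drift» ∕ (hW, hWall); NEVER «G-an2-4 closed» as (CONV-C); NOT D1, NOT `BetaPertH`, NOT continuum, NOT Clay.  2026-08-23; no existing file touched.
-/

noncomputable section

open Finset
open scoped BigOperators
open Literature.MathematicalPhysics.QuantumFieldTheory
open Literature.MathematicalPhysics.QuantumFieldTheory.Balaban1983to89
open Literature.MathematicalPhysics.QuantumFieldTheory.Balaban1983to89.Beta
open B12Sec2to5 (l1)
open ExpKernelCalculus (Site MKer shiftK Decays Zl summable_exp_shift tsum_exp_shift)
open OneStepResolventKernel (Fib LocStencil)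
open OneStepKernelFamily (KInvStep vertexOfK)
open AffineAveraging (box toSite)
open BalabanStepJetsSucc (E2 wVH)
open StepJetData (locStencil_smul)
open Summit.QuantumFields.BalabanUV.Beta.AxialDressingRooted (coDressKBmAt decays_coDressKBmAt_KInvStep one_le_of_neZero)
open Summit.QuantumFields.BalabanUV.Beta.HessKerDressedUnits (unitK unitS decays_unitK)
open Summit.QuantumFields.BalabanUV.Beta.SpineRooted (e3OfK locStencil_e3OfK e3OfK_translate)
open Summit.QuantumFields.BalabanUV.Beta.WardLocusRecursive (SrecAt locStencil_SrecAt SrecAt_translate)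
open Summit.QuantumFields.BalabanUV.Beta.GAN24.RespGaugeStencil (decays_tsum_of_biLoc_family)
open Summit.QuantumFields.BalabanUV.Beta.GAN24.ValueHessianLinearGauge (tsum_E2_mul_exitFace_eq_zero')
open Summit.QuantumFields.BalabanUV.Beta.GAN24.StepCovarianceSandwichApply (summable_apply_bdd)
open Summit.QuantumFields.BalabanUV.Beta.GAN24.ExitFaceHalfVertexSplit (faceface_e3OfK_split_sawtooth faceface_e3OfK_split_fst_sawtooth abs_csawtooth_le
  summable_E2_mul_linGrowth_face)
open Summit.QuantumFields.BalabanUV.Beta.GAN24.ExchangeE2E2ChannelTools (unitS_smul_inl_inl faceface_unitS_smul)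
open Summit.QuantumFields.BalabanUV.Beta.GAN24.ExchangeE2E2ChannelValue (exists_abs_E2_apply_le abs_sawFace_le sum_mul_ite_leg sum_box_channel_sawFace)
open Summit.QuantumFields.BalabanUV.Beta.GAN24.ExchangeWordCellPairing (exchangeWord_eq_cellPairing)

namespace Summit.QuantumFields.BalabanUV.Beta.GAN24.ExchangeE2E2Channel

variable {d : ℕ} {Lc : ℕ} [NeZero Lc] {r : Fin (d + 1) → ℕ}

/-! ## §1 The E-sector table is admissible; units through the first-slot two-face sum -/

/-- [folklore] The E-sector table `cE • V_j` is a local stencil family at a positive rate (`locStencil_SrecAt`, `locStencil_e3OfK`, `locStencil_smul`). -/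
theorem locStencil_sectorTable (hr : r ∈ box (d + 1) Lc) (cE cΛ : ℝ) (j : ℕ) :
    ∃ Cs δs : ℝ, 0 < δs ∧ LocStencil (fun κ u => cE • e3OfK Lc (coDressKBmAt (toSite r) Lc (KInvStep (d := d) Lc j))
      (SrecAt d Lc (toSite r) ((Lc : ℝ) ^ (d + 1)) (-((Lc : ℝ) ^ (d + 1) * (1 / 2) * (Lc : ℝ) ^ (d + 1))) cΛ j) κ u) Cs δs := by
  have hLc : 1 ≤ Lc := one_le_of_neZero Lc
  obtain ⟨Cs, δs, hδs, hS⟩ := locStencil_SrecAt (d := d) hLc hr ((Lc : ℝ) ^ (d + 1)) (-((Lc : ℝ) ^ (d + 1) * (1 / 2) * (Lc : ℝ) ^ (d + 1))) cΛ j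
  obtain ⟨C, δ, hδ, hV⟩ := locStencil_e3OfK (N := Lc) hLc (decays_coDressKBmAt_KInvStep (d := d) hr j) hS hδs
  exact ⟨_, δ, hδ, locStencil_smul cE hV⟩

/-- [folklore] The E-sector table is fine-translation covariant in its slot (the slot of `e3OfK` is a coarse bond: `e3OfK_translate` over `SrecAt_translate`). -/
theorem sectorTable_translate (cE cΛ : ℝ) (j : ℕ) (κ : Fin (d + 1)) (u v : Fin (d + 1) → ℤ) :
    (fun κ u => cE • e3OfK Lc (coDressKBmAt (toSite r) Lc (KInvStep (d := d) Lc j))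
        (SrecAt d Lc (toSite r) ((Lc : ℝ) ^ (d + 1)) (-((Lc : ℝ) ^ (d + 1) * (1 / 2) * (Lc : ℝ) ^ (d + 1))) cΛ j) κ u) κ (u + v) =
      shiftK (-v) ((fun κ u => cE • e3OfK Lc (coDressKBmAt (toSite r) Lc (KInvStep (d := d) Lc j))
        (SrecAt d Lc (toSite r) ((Lc : ℝ) ^ (d + 1)) (-((Lc : ℝ) ^ (d + 1) * (1 / 2) * (Lc : ℝ) ^ (d + 1))) cΛ j) κ u) κ u) := by
  have hLc : 1 ≤ Lc := one_le_of_neZero Lc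
  have h := e3OfK_translate (N := Lc) (AxialDressingRooted.shiftK_coDressKBmAt_KInvStep (d := d) (toSite r) j)
    (S := SrecAt d Lc (toSite r) ((Lc : ℝ) ^ (d + 1)) (-((Lc : ℝ) ^ (d + 1) * (1 / 2) * (Lc : ℝ) ^ (d + 1))) cΛ j)
    (SrecAt_translate (toSite r) hLc ((Lc : ℝ) ^ (d + 1)) (-((Lc : ℝ) ^ (d + 1) * (1 / 2) * (Lc : ℝ) ^ (d + 1))) cΛ j) κ u v
  funext x z a b
  simp only [Pi.smul_apply, smul_eq_mul, shiftK, h]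

omit [NeZero Lc] in
/-- [folklore] Units and the sector weight through the FIRST-slot two-face sum (twin of `ExchangeE2E2ChannelTools.faceface_unitS_smul`). -/
theorem faceface_unitS_smul_fst (sf sm c : ℝ) (V : Fin (d + 1) → (Fin (d + 1) → ℤ) → MKer (d + 1) (Fib d)) (μ : Fin (d + 1)) (P : (Fin (d + 1) → ℤ) → Prop)
    [DecidablePred P] (wL : (Fin (d + 1) → ℤ) → ℝ) (x : Fin (d + 1) → ℤ) (α a : Fin (d + 1)) :
    (∑' y : Fin (d + 1) → ℤ, wL y * ∑' t : Fin (d + 1) → ℤ, (if P t then unitS sf sm (fun κ u => c • V κ u) μ t y x (Sum.inl α) (Sum.inl a) else 0)) =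
      ((sf * sm)⁻¹ * (sf⁻¹ * sf⁻¹) * c) *
        ∑' y : Fin (d + 1) → ℤ, wL y * ∑' t : Fin (d + 1) → ℤ, (if P t then V μ t y x (Sum.inl α) (Sum.inl a) else 0) := by
  have hin : ∀ y : Fin (d + 1) → ℤ, (∑' t : Fin (d + 1) → ℤ, (if P t then unitS sf sm (fun κ u => c • V κ u) μ t y x (Sum.inl α) (Sum.inl a) else 0)) =
      ((sf * sm)⁻¹ * (sf⁻¹ * sf⁻¹) * c) * ∑' t : Fin (d + 1) → ℤ, (if P t then V μ t y x (Sum.inl α) (Sum.inl a) else 0) := by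
    intro y
    rw [← tsum_mul_left]
    refine tsum_congr fun t => ?_
    split_ifs
    · exact unitS_smul_inl_inl sf sm c V μ t y x α a
    · exact (mul_zero _).symm
  simp_rw [hin]
  rw [← tsum_mul_left]
  exact tsum_congr fun y => by ring

/-! ## §2 The dressed step kernel on the split right half-vertex -/

section Split

/-- [folklore] The right tower slot `τ_R(b,z) = Σ'_{s′} χ_β(s′)·Σ'_t V_j ν t z s′ (inl b)(inl β)` is uniformly bounded (the `t`-resummed table decays in `(z, s′)`:
`decays_tsum_of_biLoc_family`). -/
theorem abs_towerSlotR_le (hr : r ∈ box (d + 1) Lc) (cΛ : ℝ) (j : ℕ) (ν β : Fin (d + 1)) :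
    ∃ M : ℝ, ∀ (b : Fin (d + 1)) (z : Site (d + 1)),
      |∑' s' : Site (d + 1), (if s' β % (Lc : ℤ) = (Lc : ℤ) - 1 then
          ∑' t : Site (d + 1), e3OfK Lc (coDressKBmAt (toSite r) Lc (KInvStep (d := d) Lc j))
            (SrecAt d Lc (toSite r) ((Lc : ℝ) ^ (d + 1)) (-((Lc : ℝ) ^ (d + 1) * (1 / 2) * (Lc : ℝ) ^ (d + 1))) cΛ j) ν t z s' (Sum.inl b) (Sum.inl β) else 0)| ≤ M := by
  have hLc : 1 ≤ Lc := one_le_of_neZero Lc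
  set V := e3OfK Lc (coDressKBmAt (toSite r) Lc (KInvStep (d := d) Lc j))
    (SrecAt d Lc (toSite r) ((Lc : ℝ) ^ (d + 1)) (-((Lc : ℝ) ^ (d + 1) * (1 / 2) * (Lc : ℝ) ^ (d + 1))) cΛ j) with hVdef
  obtain ⟨Cs, δs, hδs, hS⟩ := locStencil_SrecAt (d := d) hLc hr ((Lc : ℝ) ^ (d + 1)) (-((Lc : ℝ) ^ (d + 1) * (1 / 2) * (Lc : ℝ) ^ (d + 1))) cΛ j
  obtain ⟨C, δ, hδ, hV⟩ := locStencil_e3OfK (N := Lc) hLc (decays_coDressKBmAt_KInvStep (d := d) hr j) hS hδs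
  rw [← hVdef] at hV
  have hC : 0 ≤ C := (hV 0 0).nonneg (Sum.inl 0)
  have hdec := decays_tsum_of_biLoc_family (T := fun t => V ν t) (fun t => hV ν t) hδ hC
  refine ⟨C * Zl (d + 1) (δ / 2) * Zl (d + 1) (δ / 2), fun b z => ?_⟩
  have hmaj : Summable fun s' : Site (d + 1) => C * Zl (d + 1) (δ / 2) * Real.exp (-(δ / 2) * l1 (z - s')) :=
    (summable_exp_shift (half_pos hδ) z).mul_left _
  have hle : ∀ s' : Site (d + 1), ‖(if s' β % (Lc : ℤ) = (Lc : ℤ) - 1 then ∑' t : Site (d + 1), V ν t z s' (Sum.inl b) (Sum.inl β) else 0)‖ ≤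
      C * Zl (d + 1) (δ / 2) * Real.exp (-(δ / 2) * l1 (z - s')) := by
    intro s'
    rw [Real.norm_eq_abs]
    split_ifs
    · exact hdec z s' (Sum.inl b) (Sum.inl β)
    · rw [abs_zero]; exact (abs_nonneg _).trans (hdec z s' (Sum.inl b) (Sum.inl β))
  have hs : Summable fun s' : Site (d + 1) => ‖(if s' β % (Lc : ℤ) = (Lc : ℤ) - 1 then ∑' t : Site (d + 1), V ν t z s' (Sum.inl b) (Sum.inl β) else 0)‖ :=
    Summable.of_nonneg_of_le (fun _ => norm_nonneg _) hle hmaj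
  calc |∑' s' : Site (d + 1), (if s' β % (Lc : ℤ) = (Lc : ℤ) - 1 then ∑' t : Site (d + 1), V ν t z s' (Sum.inl b) (Sum.inl β) else 0)|
      ≤ ∑' s' : Site (d + 1), ‖(if s' β % (Lc : ℤ) = (Lc : ℤ) - 1 then ∑' t : Site (d + 1), V ν t z s' (Sum.inl b) (Sum.inl β) else 0)‖ := by
        rw [← Real.norm_eq_abs]; exact norm_tsum_le_tsum_norm hs
    _ ≤ ∑' s' : Site (d + 1), C * Zl (d + 1) (δ / 2) * Real.exp (-(δ / 2) * l1 (z - s')) := Summable.tsum_le_tsum hle hs hmaj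
    _ = C * Zl (d + 1) (δ / 2) * Zl (d + 1) (δ / 2) := by rw [tsum_mul_left, tsum_exp_shift z]

/-- [folklore] **THE DRESSED STEP KERNEL ON THE SPLIT RIGHT HALF-VERTEX**: with `FF_R(b,z) = Σ'_{s′} χ_β(s′)·Σ'_t χ_ν(t)·(unitS sf sm S_E) ν t z s′ (inl b)(inl β)`,
`(X̃♮ FF_R)(a,x) = K_E·(Lc⁻¹·(X̃♮ τ_R)(a,x) − (2Lc)⁻¹·(X̃♮ e_R)(a,x))` — units through the two-face sum (Tools §1), the split `faceface_e3OfK_split_sawtooth`, and linearity of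
`X̃♮` on the two bounded pieces (`summable_apply_bdd`). -/
theorem dressedStep_apply_faceface_split (hr : r ∈ box (d + 1) Lc) (sf sm cE cΛ : ℝ) (j : ℕ) (ν β : Fin (d + 1)) (x : Site (d + 1)) (a : Fin (d + 1)) :
    (∑' z : Site (d + 1), ∑ b : Fin (d + 1), unitK sf sm (coDressKBmAt (toSite r) Lc (KInvStep (d := d) Lc (j + 1))) x z (Sum.inl a) (Sum.inl b) *
        (∑' s' : Site (d + 1), (if s' β % (Lc : ℤ) = (Lc : ℤ) - 1 then (1 : ℝ) else 0) *
          ∑' t : Site (d + 1), (if t ν % (Lc : ℤ) = (Lc : ℤ) - 1 then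
            unitS sf sm (fun κ u => cE • e3OfK Lc (coDressKBmAt (toSite r) Lc (KInvStep (d := d) Lc j))
              (SrecAt d Lc (toSite r) ((Lc : ℝ) ^ (d + 1)) (-((Lc : ℝ) ^ (d + 1) * (1 / 2) * (Lc : ℝ) ^ (d + 1))) cΛ j) κ u) ν t z s' (Sum.inl b) (Sum.inl β)
            else 0))) =
      ((sf * sm)⁻¹ * (sf⁻¹ * sf⁻¹) * cE) *
        ((Lc : ℝ)⁻¹ * (∑' z : Site (d + 1), ∑ b : Fin (d + 1), unitK sf sm (coDressKBmAt (toSite r) Lc (KInvStep (d := d) Lc (j + 1))) x z (Sum.inl a) (Sum.inl b) *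
            ∑' s' : Site (d + 1), (if s' β % (Lc : ℤ) = (Lc : ℤ) - 1 then
              ∑' t : Site (d + 1), e3OfK Lc (coDressKBmAt (toSite r) Lc (KInvStep (d := d) Lc j))
                (SrecAt d Lc (toSite r) ((Lc : ℝ) ^ (d + 1)) (-((Lc : ℝ) ^ (d + 1) * (1 / 2) * (Lc : ℝ) ^ (d + 1))) cΛ j) ν t z s' (Sum.inl b) (Sum.inl β) else 0))
          - (2 * (Lc : ℝ))⁻¹ * (∑' z : Site (d + 1), ∑ b : Fin (d + 1), unitK sf sm (coDressKBmAt (toSite r) Lc (KInvStep (d := d) Lc (j + 1))) x z (Sum.inl a) (Sum.inl b) *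
            ∑' s' : Site (d + 1), E2 d Lc (j + 1) z s' (Sum.inl b) (Sum.inl β) *
              ((((s' ν % (Lc : ℤ) : ℤ) : ℝ)) * (if s' β % (Lc : ℤ) = (Lc : ℤ) - 1 then (1 : ℝ) else 0)))) := by
  have hLc : 1 ≤ Lc := one_le_of_neZero Lc
  set V := e3OfK Lc (coDressKBmAt (toSite r) Lc (KInvStep (d := d) Lc j))
    (SrecAt d Lc (toSite r) ((Lc : ℝ) ^ (d + 1)) (-((Lc : ℝ) ^ (d + 1) * (1 / 2) * (Lc : ℝ) ^ (d + 1))) cΛ j) with hVdef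
  set X := unitK sf sm (coDressKBmAt (toSite r) Lc (KInvStep (d := d) Lc (j + 1))) with hXdef
  set K : ℝ := (sf * sm)⁻¹ * (sf⁻¹ * sf⁻¹) * cE with hK
  -- the two pieces of the split, as field-leg data
  set TR : Fin (d + 1) → Site (d + 1) → ℝ := fun b z => ∑' s' : Site (d + 1), (if s' β % (Lc : ℤ) = (Lc : ℤ) - 1 then
    ∑' t : Site (d + 1), V ν t z s' (Sum.inl b) (Sum.inl β) else 0) with hTR
  set ER : Fin (d + 1) → Site (d + 1) → ℝ := fun b z => ∑' s' : Site (d + 1), E2 d Lc (j + 1) z s' (Sum.inl b) (Sum.inl β) *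
    ((((s' ν % (Lc : ℤ) : ℤ) : ℝ)) * (if s' β % (Lc : ℤ) = (Lc : ℤ) - 1 then (1 : ℝ) else 0)) with hER
  -- pointwise in `(b, z)`: units out, then the split
  have hpt : ∀ (b : Fin (d + 1)) (z : Site (d + 1)),
      (∑' s' : Site (d + 1), (if s' β % (Lc : ℤ) = (Lc : ℤ) - 1 then (1 : ℝ) else 0) *
        ∑' t : Site (d + 1), (if t ν % (Lc : ℤ) = (Lc : ℤ) - 1 then unitS sf sm (fun κ u => cE • V κ u) ν t z s' (Sum.inl b) (Sum.inl β) else 0)) =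
      K * ((Lc : ℝ)⁻¹ * TR b z - (2 * (Lc : ℝ))⁻¹ * ER b z) := by
    intro b z
    rw [faceface_unitS_smul sf sm cE V ν (fun t : Site (d + 1) => t ν % (Lc : ℤ) = (Lc : ℤ) - 1)
      (fun s' : Site (d + 1) => (if s' β % (Lc : ℤ) = (Lc : ℤ) - 1 then (1 : ℝ) else 0)) z b β]
    have hbm : (∑' s' : Site (d + 1), (if s' β % (Lc : ℤ) = (Lc : ℤ) - 1 then (1 : ℝ) else 0) *
        ∑' t : Site (d + 1), (if t ν % (Lc : ℤ) = (Lc : ℤ) - 1 then V ν t z s' (Sum.inl b) (Sum.inl β) else 0)) =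
        ∑' s' : Site (d + 1), (if s' β % (Lc : ℤ) = (Lc : ℤ) - 1 then
          ∑' t : Site (d + 1), (if t ν % (Lc : ℤ) = (Lc : ℤ) - 1 then V ν t z s' (Sum.inl b) (Sum.inl β) else 0) else 0) :=
      tsum_congr fun s' => by rw [boole_mul]
    rw [hbm, hVdef, faceface_e3OfK_split_sawtooth hr cΛ j ν z b β]
  -- boundedness of the two pieces
  obtain ⟨MT, hMT⟩ := abs_towerSlotR_le hr cΛ j ν β
  have hTRB : ∀ b z, |TR b z| ≤ MT := fun b z => hMT b z
  have hERq : ∀ (b : Fin (d + 1)) (z : Site (d + 1)), ER b z = ∑' s' : Site (d + 1), ∑ b' : Fin (d + 1), E2 d Lc (j + 1) z s' (Sum.inl b) (Sum.inl b') *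
      (if b' = β then ((1 : ℝ) * ((((s' ν % (Lc : ℤ) : ℤ) : ℝ)) - 0)) * (if s' β % (Lc : ℤ) = (Lc : ℤ) - 1 then (1 : ℝ) else 0) else 0) := by
    intro b z
    rw [hER]
    refine tsum_congr fun s' => ?_
    rw [sum_mul_ite_leg, one_mul, sub_zero]
  obtain ⟨ME, hME⟩ := exists_abs_E2_apply_le (d := d) (Lc := Lc) (j + 1)
    (h := fun b' (s' : Site (d + 1)) => if b' = β then ((1 : ℝ) * ((((s' ν % (Lc : ℤ) : ℤ) : ℝ)) - 0)) * (if s' β % (Lc : ℤ) = (Lc : ℤ) - 1 then (1 : ℝ) else 0) else 0)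
    (fun b' s' => abs_sawFace_le hLc 1 0 ν β b' s')
  have hERB : ∀ b z, |ER b z| ≤ ME := fun b z => by rw [hERq]; exact hME z b
  -- summability of `X̃♮` against each piece
  obtain ⟨δG, CG, hδG, -, hG⟩ := decays_coDressKBmAt_KInvStep (d := d) hr (j + 1)
  have hXd : Decays X (max |sf| |sm| * CG * max |sf| |sm|) δG := decays_unitK hG
  have hsT : Summable fun z : Site (d + 1) => ∑ b : Fin (d + 1), X x z (Sum.inl a) (Sum.inl b) * TR b z := summable_apply_bdd hXd hδG hTRB x (Sum.inl a)
  have hsE : Summable fun z : Site (d + 1) => ∑ b : Fin (d + 1), X x z (Sum.inl a) (Sum.inl b) * ER b z := summable_apply_bdd hXd hδG hERB x (Sum.inl a)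
  -- assemble
  have hz : ∀ z : Site (d + 1), (∑ b : Fin (d + 1), X x z (Sum.inl a) (Sum.inl b) * (K * ((Lc : ℝ)⁻¹ * TR b z - (2 * (Lc : ℝ))⁻¹ * ER b z))) =
      K * (Lc : ℝ)⁻¹ * (∑ b : Fin (d + 1), X x z (Sum.inl a) (Sum.inl b) * TR b z) -
        K * (2 * (Lc : ℝ))⁻¹ * (∑ b : Fin (d + 1), X x z (Sum.inl a) (Sum.inl b) * ER b z) := by
    intro z
    rw [Finset.mul_sum, Finset.mul_sum, ← Finset.sum_sub_distrib]
    exact Finset.sum_congr rfl fun b _ => by ring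
  simp_rw [hpt, hz]
  rw [((hsT.mul_left _).tsum_sub (hsE.mul_left _)), tsum_mul_left, tsum_mul_left]
  simp only [hTR, hER, hK]
  ring

end Split

/-! ## §3 The E-sector EE word in two-face currency -/

/-- [folklore] **THE E-SECTOR EE WORD OF ROW (C) IN TWO-FACE CURRENCY** (every `j`, in-block root, all units, amplitude `cE`, any `cΛ`):
the reduced EE word AT LEVEL `j+1` (vertices and middle kernel `X̃♮ = unitK sf sm G_{j+1}`) of the table `S_E = cE • V_j` `= |box|·c₀σ_{j+1}²·Σ_{x∈box} Σ_a [K_E·(Lc⁻¹τ_L + (2Lc)⁻¹e_L)](a,x) · [K_E·(Lc⁻¹·X̃♮τ_R − (2Lc)⁻¹·X̃♮e_R)](a,x)`. -/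
theorem exchangeWord_sector_eq (hr : r ∈ box (d + 1) Lc) (sf sm cE cΛ : ℝ) (j : ℕ) (μ α ν β : Fin (d + 1)) :
    ∑ u ∈ box (d + 1) Lc, ∑' y₁ : Site (d + 1), ∑ a : Fin (d + 1),
        (∑' y : Site (d + 1), (if y α % (Lc : ℤ) = (Lc : ℤ) - 1 then (1 : ℝ) else 0) *
          vertexOfK (unitK sf sm (coDressKBmAt (toSite r) Lc (KInvStep (d := d) Lc (j + 1)))) Lc
            (unitS sf sm (fun κ u => cE • e3OfK Lc (coDressKBmAt (toSite r) Lc (KInvStep (d := d) Lc j))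
              (SrecAt d Lc (toSite r) ((Lc : ℝ) ^ (d + 1)) (-((Lc : ℝ) ^ (d + 1) * (1 / 2) * (Lc : ℝ) ^ (d + 1))) cΛ j) κ u)) μ (toSite u) y y₁ (Sum.inl α) (Sum.inl a)) *
        (∑' z : Site (d + 1), ∑ b : Fin (d + 1), unitK sf sm (coDressKBmAt (toSite r) Lc (KInvStep (d := d) Lc (j + 1))) y₁ z (Sum.inl a) (Sum.inl b) *
          (∑' u' : Site (d + 1), ∑' w : Site (d + 1), (if w β % (Lc : ℤ) = (Lc : ℤ) - 1 then (1 : ℝ) else 0) *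
            vertexOfK (unitK sf sm (coDressKBmAt (toSite r) Lc (KInvStep (d := d) Lc (j + 1)))) Lc
              (unitS sf sm (fun κ u => cE • e3OfK Lc (coDressKBmAt (toSite r) Lc (KInvStep (d := d) Lc j))
                (SrecAt d Lc (toSite r) ((Lc : ℝ) ^ (d + 1)) (-((Lc : ℝ) ^ (d + 1) * (1 / 2) * (Lc : ℝ) ^ (d + 1))) cΛ j) κ u)) ν u' z w (Sum.inl b) (Sum.inl β))) =
      ((box (d + 1) Lc).card : ℝ) * (((Lc : ℝ) * (sm * sf)) * ((((Lc ^ (j + 1 + 1) : ℕ) : ℝ)) ^ (d + 1 + 1))⁻¹) ^ 2 *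
        ∑ x ∈ box (d + 1) Lc, ∑ a : Fin (d + 1),
          (((sf * sm)⁻¹ * (sf⁻¹ * sf⁻¹) * cE) *
            ((Lc : ℝ)⁻¹ * (∑' y : Site (d + 1), (if y α % (Lc : ℤ) = (Lc : ℤ) - 1 then
                ∑' t : Site (d + 1), e3OfK Lc (coDressKBmAt (toSite r) Lc (KInvStep (d := d) Lc j))
                  (SrecAt d Lc (toSite r) ((Lc : ℝ) ^ (d + 1)) (-((Lc : ℝ) ^ (d + 1) * (1 / 2) * (Lc : ℝ) ^ (d + 1))) cΛ j) μ t y (toSite x) (Sum.inl α) (Sum.inl a)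
                else 0))
              + (2 * (Lc : ℝ))⁻¹ * ∑' y : Site (d + 1), ((((y μ % (Lc : ℤ) : ℤ) : ℝ)) * (if y α % (Lc : ℤ) = (Lc : ℤ) - 1 then (1 : ℝ) else 0)) *
                E2 d Lc (j + 1) y (toSite x) (Sum.inl α) (Sum.inl a))) *
          (((sf * sm)⁻¹ * (sf⁻¹ * sf⁻¹) * cE) *
            ((Lc : ℝ)⁻¹ * (∑' z : Site (d + 1), ∑ b : Fin (d + 1), unitK sf sm (coDressKBmAt (toSite r) Lc (KInvStep (d := d) Lc (j + 1))) (toSite x) z (Sum.inl a) (Sum.inl b) *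
                ∑' s' : Site (d + 1), (if s' β % (Lc : ℤ) = (Lc : ℤ) - 1 then
                  ∑' t : Site (d + 1), e3OfK Lc (coDressKBmAt (toSite r) Lc (KInvStep (d := d) Lc j))
                    (SrecAt d Lc (toSite r) ((Lc : ℝ) ^ (d + 1)) (-((Lc : ℝ) ^ (d + 1) * (1 / 2) * (Lc : ℝ) ^ (d + 1))) cΛ j) ν t z s' (Sum.inl b) (Sum.inl β) else 0))
              - (2 * (Lc : ℝ))⁻¹ * (∑' z : Site (d + 1), ∑ b : Fin (d + 1), unitK sf sm (coDressKBmAt (toSite r) Lc (KInvStep (d := d) Lc (j + 1))) (toSite x) z (Sum.inl a) (Sum.inl b) *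
                ∑' s' : Site (d + 1), E2 d Lc (j + 1) z s' (Sum.inl b) (Sum.inl β) *
                  ((((s' ν % (Lc : ℤ) : ℤ) : ℝ)) * (if s' β % (Lc : ℤ) = (Lc : ℤ) - 1 then (1 : ℝ) else 0))))) := by
  have hLc : 1 ≤ Lc := one_le_of_neZero Lc
  obtain ⟨Cs, δs, hδs, hS⟩ := locStencil_sectorTable (d := d) hr cE cΛ j
  rw [exchangeWord_eq_cellPairing (μ := μ) (α := α) (ν := ν) (β := β) hr hS hδs (fun κ u v => sectorTable_translate (r := r) cE cΛ j κ u v) sf sm (j + 1)]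
  refine congrArg (fun t : ℝ => ((box (d + 1) Lc).card : ℝ) * (((Lc : ℝ) * (sm * sf)) * ((((Lc ^ (j + 1 + 1) : ℕ) : ℝ)) ^ (d + 1 + 1))⁻¹) ^ 2 * t)
    (Finset.sum_congr rfl fun x _ => Finset.sum_congr rfl fun a _ => ?_)
  -- left factor: units out, indicator in, the first-leg split
  have hL : (∑' y : Site (d + 1), (if y α % (Lc : ℤ) = (Lc : ℤ) - 1 then (1 : ℝ) else 0) *
      ∑' t : Site (d + 1), (if t μ % (Lc : ℤ) = (Lc : ℤ) - 1 then
        unitS sf sm (fun κ u => cE • e3OfK Lc (coDressKBmAt (toSite r) Lc (KInvStep (d := d) Lc j))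
          (SrecAt d Lc (toSite r) ((Lc : ℝ) ^ (d + 1)) (-((Lc : ℝ) ^ (d + 1) * (1 / 2) * (Lc : ℝ) ^ (d + 1))) cΛ j) κ u) μ t y (toSite x) (Sum.inl α) (Sum.inl a)
        else 0)) =
      ((sf * sm)⁻¹ * (sf⁻¹ * sf⁻¹) * cE) *
        ((Lc : ℝ)⁻¹ * (∑' y : Site (d + 1), (if y α % (Lc : ℤ) = (Lc : ℤ) - 1 then
            ∑' t : Site (d + 1), e3OfK Lc (coDressKBmAt (toSite r) Lc (KInvStep (d := d) Lc j))
              (SrecAt d Lc (toSite r) ((Lc : ℝ) ^ (d + 1)) (-((Lc : ℝ) ^ (d + 1) * (1 / 2) * (Lc : ℝ) ^ (d + 1))) cΛ j) μ t y (toSite x) (Sum.inl α) (Sum.inl a)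
            else 0))
          + (2 * (Lc : ℝ))⁻¹ * ∑' y : Site (d + 1), ((((y μ % (Lc : ℤ) : ℤ) : ℝ)) * (if y α % (Lc : ℤ) = (Lc : ℤ) - 1 then (1 : ℝ) else 0)) *
            E2 d Lc (j + 1) y (toSite x) (Sum.inl α) (Sum.inl a)) := by
    rw [faceface_unitS_smul_fst sf sm cE _ μ (fun t : Site (d + 1) => t μ % (Lc : ℤ) = (Lc : ℤ) - 1)
      (fun y : Site (d + 1) => (if y α % (Lc : ℤ) = (Lc : ℤ) - 1 then (1 : ℝ) else 0)) (toSite x) α a]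
    congr 1
    have hbm : (∑' y : Site (d + 1), (if y α % (Lc : ℤ) = (Lc : ℤ) - 1 then (1 : ℝ) else 0) *
        ∑' t : Site (d + 1), (if t μ % (Lc : ℤ) = (Lc : ℤ) - 1 then e3OfK Lc (coDressKBmAt (toSite r) Lc (KInvStep (d := d) Lc j))
          (SrecAt d Lc (toSite r) ((Lc : ℝ) ^ (d + 1)) (-((Lc : ℝ) ^ (d + 1) * (1 / 2) * (Lc : ℝ) ^ (d + 1))) cΛ j) μ t y (toSite x) (Sum.inl α) (Sum.inl a) else 0)) =
        ∑' y : Site (d + 1), (if y α % (Lc : ℤ) = (Lc : ℤ) - 1 then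
          ∑' t : Site (d + 1), (if t μ % (Lc : ℤ) = (Lc : ℤ) - 1 then e3OfK Lc (coDressKBmAt (toSite r) Lc (KInvStep (d := d) Lc j))
            (SrecAt d Lc (toSite r) ((Lc : ℝ) ^ (d + 1)) (-((Lc : ℝ) ^ (d + 1) * (1 / 2) * (Lc : ℝ) ^ (d + 1))) cΛ j) μ t y (toSite x) (Sum.inl α) (Sum.inl a) else 0)
          else 0) :=
      tsum_congr fun y => by rw [boole_mul]
    rw [hbm, faceface_e3OfK_split_fst_sawtooth hr cΛ j μ (toSite x) α a]
  rw [hL, dressedStep_apply_faceface_split hr sf sm cE cΛ j ν β (toSite x) a]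

/-! ## §4 The `e–e` channel evaluated -/

/-- [folklore] **`e_R` IS UNCHANGED BY CENTRING THE SAWTOOTH**: `Σ'_{s′} E2(z,s′)_{bβ}·(λ_νχ_β)(s′) = Σ'_{s′} E2(z,s′)_{bβ}·((1·(λ_ν − (Lc−1)∕2))χ_β)(s′)` — the difference is a constant
times `Σ'_{s′} E2(z,s′)_{bβ}·χ_β(s′) = 0` (D1 §3 `tsum_E2_mul_exitFace_eq_zero'`). -/
theorem eR_eq_centred (j : ℕ) (ν β b : Fin (d + 1)) (z : Site (d + 1)) :
    (∑' s', E2 d Lc (j + 1) z s' (Sum.inl b) (Sum.inl β) * ((((s' ν % (Lc : ℤ) : ℤ) : ℝ)) * (if s' β % (Lc : ℤ) = (Lc : ℤ) - 1 then (1 : ℝ) else 0))) =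
      ∑' s', E2 d Lc (j + 1) z s' (Sum.inl b) (Sum.inl β) *
        (((1 : ℝ) * ((((s' ν % (Lc : ℤ) : ℤ) : ℝ)) - ((Lc : ℝ) - 1) / 2)) * (if s' β % (Lc : ℤ) = (Lc : ℤ) - 1 then (1 : ℝ) else 0)) := by
  have hLc : 1 ≤ Lc := one_le_of_neZero Lc
  have hA : Summable fun s' : Fin (d + 1) → ℤ => E2 d Lc (j + 1) z s' (Sum.inl b) (Sum.inl β) *
      (((1 : ℝ) * ((((s' ν % (Lc : ℤ) : ℤ) : ℝ)) - ((Lc : ℝ) - 1) / 2)) * (if s' β % (Lc : ℤ) = (Lc : ℤ) - 1 then (1 : ℝ) else 0)) :=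
    summable_E2_mul_linGrowth_face (Lc := Lc) j (lam := fun s' : Fin (d + 1) → ℤ => (1 : ℝ) * ((((s' ν % (Lc : ℤ) : ℤ) : ℝ)) - ((Lc : ℝ) - 1) / 2))
      (A := (Lc : ℝ) + |((Lc : ℝ) - 1) / 2|) (B := 0) (fun t => by rw [one_mul]; exact abs_csawtooth_le hLc _ ν t) z b β
  have hB : Summable fun s' : Fin (d + 1) → ℤ => E2 d Lc (j + 1) z s' (Sum.inl b) (Sum.inl β) *
      ((((Lc : ℝ) - 1) / 2) * (if s' β % (Lc : ℤ) = (Lc : ℤ) - 1 then (1 : ℝ) else 0)) :=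
    summable_E2_mul_linGrowth_face (Lc := Lc) j (lam := fun _ : Fin (d + 1) → ℤ => ((Lc : ℝ) - 1) / 2) (A := |((Lc : ℝ) - 1) / 2|) (B := 0)
      (fun t => by rw [zero_mul, add_zero]) z b β
  have h0 : (∑' s', E2 d Lc (j + 1) z s' (Sum.inl b) (Sum.inl β) * ((((Lc : ℝ) - 1) / 2) * (if s' β % (Lc : ℤ) = (Lc : ℤ) - 1 then (1 : ℝ) else 0))) = 0 := by
    have h := tsum_E2_mul_exitFace_eq_zero' (Lc := Lc) (j + 1) hLc b β z (((Lc : ℝ) - 1) / 2)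
    simpa only [mul_boole] using h
  calc (∑' s', E2 d Lc (j + 1) z s' (Sum.inl b) (Sum.inl β) * ((((s' ν % (Lc : ℤ) : ℤ) : ℝ)) * (if s' β % (Lc : ℤ) = (Lc : ℤ) - 1 then (1 : ℝ) else 0)))
      = ∑' s', (E2 d Lc (j + 1) z s' (Sum.inl b) (Sum.inl β) *
          (((1 : ℝ) * ((((s' ν % (Lc : ℤ) : ℤ) : ℝ)) - ((Lc : ℝ) - 1) / 2)) * (if s' β % (Lc : ℤ) = (Lc : ℤ) - 1 then (1 : ℝ) else 0)) +
          E2 d Lc (j + 1) z s' (Sum.inl b) (Sum.inl β) * ((((Lc : ℝ) - 1) / 2) * (if s' β % (Lc : ℤ) = (Lc : ℤ) - 1 then (1 : ℝ) else 0))) :=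
        tsum_congr fun s' => by ring
    _ = _ := by rw [hA.tsum_add hB, h0, add_zero]

/-- [folklore] **THE `e–e` CHANNEL OF THE E-SECTOR EE WORD, EVALUATED** (`ν ≠ β`; every `j`, in-block root):
`Σ_{x∈box} Σ_a e_L(a,x)·(X̃♮ e_R)(a,x) = sf²·(wVH_{j+1}⁻¹·Σ_{x∈box} (λ_μχ_α)(x)·Σ'_s E2_{j+1}(x,s)_{αβ}·((1·λ̂_ν)χ_β)(s))`, `λ̂_ν = λ_ν − (Lc−1)∕2` — centring on the right
(`eR_eq_centred`), then `ExchangeE2E2ChannelValue.sum_box_channel_sawFace` with `cL = cR = 1`, `eL = 0`. This is the `e–e` pairing of `exchangeWord_sector_eq` (§3) up to its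
prefactor `|box|·c₀σ_j²·K_E²·(−(4Lc²)⁻¹)`. -/
theorem channel_ee_value (hr : r ∈ box (d + 1) Lc) (sf sm : ℝ) (j : ℕ) (μ α : Fin (d + 1)) {ν β : Fin (d + 1)} (hνβ : ν ≠ β) :
    ∑ x ∈ box (d + 1) Lc, ∑ a : Fin (d + 1),
        (∑' y, ((((y μ % (Lc : ℤ) : ℤ) : ℝ)) * (if y α % (Lc : ℤ) = (Lc : ℤ) - 1 then (1 : ℝ) else 0)) *
            E2 d Lc (j + 1) y (toSite x) (Sum.inl α) (Sum.inl a)) *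
          ∑' z, ∑ b : Fin (d + 1), unitK sf sm (coDressKBmAt (toSite r) Lc (KInvStep (d := d) Lc (j + 1))) (toSite x) z (Sum.inl a) (Sum.inl b) *
            ∑' s', E2 d Lc (j + 1) z s' (Sum.inl b) (Sum.inl β) *
              ((((s' ν % (Lc : ℤ) : ℤ) : ℝ)) * (if s' β % (Lc : ℤ) = (Lc : ℤ) - 1 then (1 : ℝ) else 0)) =
      (sf * sf) * ((wVH d Lc (j + 1))⁻¹ *
        ∑ x ∈ box (d + 1) Lc, ((((toSite x μ % (Lc : ℤ) : ℤ) : ℝ)) * (if toSite x α % (Lc : ℤ) = (Lc : ℤ) - 1 then (1 : ℝ) else 0)) *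
          ∑' s, E2 d Lc (j + 1) (toSite x) s (Sum.inl α) (Sum.inl β) *
            (((1 : ℝ) * ((((s ν % (Lc : ℤ) : ℤ) : ℝ)) - ((Lc : ℝ) - 1) / 2)) * (if s β % (Lc : ℤ) = (Lc : ℤ) - 1 then (1 : ℝ) else 0))) := by
  have h := sum_box_channel_sawFace hr sf sm j 1 0 1 μ α hνβ
  have hEL : ∀ (x : Fin (d + 1) → ℕ) (a : Fin (d + 1)),
      (∑' y, ((((y μ % (Lc : ℤ) : ℤ) : ℝ)) * (if y α % (Lc : ℤ) = (Lc : ℤ) - 1 then (1 : ℝ) else 0)) *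
          E2 d Lc (j + 1) y (toSite x) (Sum.inl α) (Sum.inl a)) =
        ∑' y, E2 d Lc (j + 1) y (toSite x) (Sum.inl α) (Sum.inl a) *
          (((1 : ℝ) * ((((y μ % (Lc : ℤ) : ℤ) : ℝ)) - 0)) * (if y α % (Lc : ℤ) = (Lc : ℤ) - 1 then (1 : ℝ) else 0)) :=
    fun x a => tsum_congr fun y => by ring
  have hER : ∀ (b : Fin (d + 1)) (z : Site (d + 1)),
      (∑' s', E2 d Lc (j + 1) z s' (Sum.inl b) (Sum.inl β) * ((((s' ν % (Lc : ℤ) : ℤ) : ℝ)) * (if s' β % (Lc : ℤ) = (Lc : ℤ) - 1 then (1 : ℝ) else 0))) =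
        ∑' s', E2 d Lc (j + 1) z s' (Sum.inl b) (Sum.inl β) *
          (((1 : ℝ) * ((((s' ν % (Lc : ℤ) : ℤ) : ℝ)) - ((Lc : ℝ) - 1) / 2)) * (if s' β % (Lc : ℤ) = (Lc : ℤ) - 1 then (1 : ℝ) else 0)) :=
    fun b z => eR_eq_centred j ν β b z
  have hxL : ∀ x : Fin (d + 1) → ℕ, ((((toSite x μ % (Lc : ℤ) : ℤ) : ℝ)) * (if toSite x α % (Lc : ℤ) = (Lc : ℤ) - 1 then (1 : ℝ) else 0)) =
      ((1 : ℝ) * ((((toSite x μ % (Lc : ℤ) : ℤ) : ℝ)) - 0)) * (if toSite x α % (Lc : ℤ) = (Lc : ℤ) - 1 then (1 : ℝ) else 0) := fun x => by ring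
  simp_rw [hEL, hER, hxL]
  exact h

end Summit.QuantumFields.BalabanUV.Beta.GAN24.ExchangeE2E2Channel

end
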